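import Summits.QuantumFields.YangMills.Theorems.BalabanUVNodesN15VectorPieceSiteMassive
import Literature.MathematicalPhysics.QuantumFieldTheory.Balaban1983to89.T4EtaRateSiteOfRatePair
import Literature.MathematicalPhysics.QuantumFieldTheory.Balaban1983to89.T4EtaRateUnitWitness

/-!
# Route «BalabanUVNodes», node N15 = NE2 — THE `A = 0` LAYER NE2⁰ BY NAME for the background-live (3.60)-words family at the piece's OWN unit forms and MASSIVE site
# forms: King's (4.38)-shaped two-spacing rate for the MODEL's `U ≡ 1` site and unit covariances, hypothesis-free in the certified windows

Cell `pub-ymgap` (HUMAN RULING D-0062, Track A), seat `pub-ymgap-dag-n15-c` (generation g6; R134 (a) N15 NE2 s1).  Count-neutral; filed `--supports` the K3⁵ item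
`SpineGivenEndpointR13SepCoP` (stmt-QuantumFields-20296, `--as helper`; dag-lead WORDS-141).  Imports BY NAME, nothing in the tree modified: g6 E2∕E3
(`…UnitOwnForm`, `…SiteMassive`: `unitData_of_le_ownWeightBound`, `siteRelDatum_of_massBound_le`, the own∕massive inverses), g5 R3s∕R3u (`ne2PlusSite_vectorPiece_vWordsExpC_rel`,
`ne2PlusUnit_vectorPiece_vWordsExpC_rel`, `SiteRelDatum`, `UnitRelDatum`), the Literature bookkeeping `T4EtaRateSiteOfRatePair.ne2ZeroSite_of_ne2PlusSite`,
`T4EtaRateUnitWitness.ne2ZeroUnit_of_ne2PlusUnit` (NE2⁺ ⇒ NE2⁰ given (3.35)∕(3.36) at the trivial configuration).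

WHAT THIS MODULE IS.  §1 `reg335_one_v1GVecInstance` ∕ `reg336_one_v1GVecInstance` (the zero gauge field satisfies the carrier's (3.35) = (3.36) letters for every
`c₃₅, α₀ ≥ 0`), `v1GVecInstance_M_pos`.  §2 the generic `A = 0` reductions on this lineage's carriers: `ne2ZeroSite_vectorPiece_vWordsExpC_rel` (any `SiteRelDatum` ⇒
`NE2ZeroSite 4 p`), `ne2ZeroUnit_vectorPiece_vWordsExpC_rel` (any `UnitRelDatum` ⇒ `NE2ZeroUnit`).  §3 ★ `ne2ZeroUnit_vectorPiece_vWordsExpC_own` (`0 < |a| ≤ a₀`: the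
two-spacing rate of the piece's OWN unit covariance `(a·1 − a²Q(G ⊗ 1)Q*)⁻¹`, dressed kernel read at `A′ = 0`, clean rate `θ < 1`, `inΛ = ⊤`), ★ `ne2ZeroSite_vectorPiece_vWordsExpC_massive`
(`c ≥ c₀`: the same for the MASSIVE site covariance `(c·1 + Q(G ⊗ 1)²Q*)⁻¹`, exponent `p` free) — King's Lemma 4.5 (4.38) SHAPE for the model's covariances, NO hypothesis
beyond the windows.

HONEST FRAMING.  Model-level (one single-scale piece ⊗ 1_𝔤; own∕massive forms are NOT King's `Δ^{(k)}` ∕ Bałaban's `Q′G′²Q′*`); the printed A = 0 statements (King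
Props 3.8–3.10, Lemma 4.5) are for the scalar U(1)-Higgs model and are NOT used as hypotheses here.  N15 NOT discharged (0∕1); typed 28∕28 unmoved; one finite T⁴
programme at fixed ε — NOT ℝ⁴, NOT OS, NOT a mass gap, NOT Clay.  0 `def`, 0 `sorry`, standard axioms.
-/

noncomputable section

open Finset

namespace Summit.QuantumFields.YangMills.BalabanUVNodes.N15.VectorPiece

open Literature.MathematicalPhysics.QuantumFieldTheory.Balaban1983to89
open Literature.MathematicalPhysics.QuantumFieldTheory.Balaban1983to89.B11SectG (BlockNorm HasMaj)
open Literature.MathematicalPhysics.QuantumFieldTheory.Balaban1983to89.T4EtaRate (PairedInstance NE2PlusSite NE2PlusUnit)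
open Literature.MathematicalPhysics.QuantumFieldTheory.Balaban1983to89.T4EtaRateSiteOfRatePair (NE2ZeroSite ne2ZeroSite_of_ne2PlusSite)
open Literature.MathematicalPhysics.QuantumFieldTheory.Balaban1983to89.T4EtaRateUnitWitness (NE2ZeroUnit ne2ZeroUnit_of_ne2PlusUnit)
open Literature.MathematicalPhysics.QuantumFieldTheory.Balaban1983to89.B5Prop11Plancherel (Tor fine)
open Summit.QuantumFields.YangMills.BalabanUVNodes.N15.MatrixSpecies (liftMap liftBlk)
open Summit.QuantumFields.YangMills.BalabanUVNodes.N15.SiteLayer (unitForm₀ msiteForm)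

variable {d : ℕ}

/-! ## §1 The zero gauge field is (3.35)- and (3.36)-regular on the gauge carriers of the family -/

section Regular

variable (𝔄 : Type) [NormedRing 𝔄] [NormedAlgebra ℝ 𝔄] [CompleteSpace 𝔄] (ι : Type) [Fintype ι] [DecidableEq ι] (L : ℕ) [NeZero L]

omit [CompleteSpace 𝔄] [DecidableEq ι] in
/-- `A′ = 0` satisfies the carrier's (3.35) letters for every `c₃₅, α₀ ≥ 0` (all three printed quantities vanish). [cite: Balaban1985BackgroundPropagators, (3.35) p.396 (shape)] -/
theorem reg335_one_v1GVecInstance (hL : 1 ≤ L) (j : VecIndexS d L) {c35 α₀ : ℝ} (hc35 : 0 ≤ c35) (hα₀ : 0 ≤ α₀) :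
    (v1GVecInstance (d := d) 𝔄 ι L hL j).Bf.Reg335 c35 α₀ (v1GVecInstance (d := d) 𝔄 ι L hL j).Bf.one := by
  have hM : 0 ≤ c35 * j.Msz * α₀ := by
    have h1 : (0 : ℝ) ≤ j.Msz := zero_le_one.trans j.one_le_Msz
    positivity
  have hLr : (0 : ℝ) ≤ (L : ℝ) := Nat.cast_nonneg L
  have hη : 0 ≤ ((L : ℝ) ^ j.k)⁻¹ * ((L : ℝ) ^ j.m)⁻¹ := mul_nonneg (inv_nonneg.2 (pow_nonneg hLr _)) (inv_nonneg.2 (pow_nonneg hLr _))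
  refine ⟨fun μ x' => ?_, fun μ κ x' => ?_, fun μ κ x' => ?_⟩
  · show ‖(0 : 𝔄)‖ ≤ c35 * j.Msz * α₀
    rw [norm_zero]; exact hM
  · show ‖(0 : 𝔄) - 0‖ ≤ c35 * j.Msz * α₀ * (((L : ℝ) ^ j.k)⁻¹ * ((L : ℝ) ^ j.m)⁻¹)
    rw [sub_zero, norm_zero]; exact mul_nonneg hM hη
  · show ‖(0 : 𝔄) - 0 - (0 - 0)‖ ≤ c35 * j.Msz * α₀ * (((L : ℝ) ^ j.k)⁻¹ * ((L : ℝ) ^ j.m)⁻¹) * (((L : ℝ) ^ j.k)⁻¹ * ((L : ℝ) ^ j.m)⁻¹)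
    rw [show (0 : 𝔄) - 0 - (0 - 0) = 0 by simp, norm_zero]; exact mul_nonneg (mul_nonneg hM hη) hη

omit [CompleteSpace 𝔄] [DecidableEq ι] in
/-- `A′ = 0` satisfies the carrier's (3.36) letters too (on this carrier (3.36) is typed by the same three letters). [cite: Balaban1985BackgroundPropagators, (3.36) p.396 (shape)] -/
theorem reg336_one_v1GVecInstance (hL : 1 ≤ L) (j : VecIndexS d L) {c35 α₀ : ℝ} (hc35 : 0 ≤ c35) (hα₀ : 0 ≤ α₀) :
    (v1GVecInstance (d := d) 𝔄 ι L hL j).Bf.Reg336 c35 α₀ (v1GVecInstance (d := d) 𝔄 ι L hL j).Bf.one :=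
  reg335_one_v1GVecInstance 𝔄 ι L hL j hc35 hα₀

omit [CompleteSpace 𝔄] [DecidableEq ι] in
/-- The fine instance's size parameter is the index's `M ≥ 1 > 0`. [folklore] -/
theorem v1GVecInstance_M_pos (hL : 1 ≤ L) (j : VecIndexS d L) : 0 < (v1GVecInstance (d := d) 𝔄 ι L hL j).gf.M :=
  lt_of_lt_of_le one_pos j.one_le_Msz

end Regular

/-! ## §2 The `A = 0` reductions for the relative families: any site ∕ unit datum ⇒ NE2⁰ -/

section Rel

variable (𝔄 : Type) [NormedRing 𝔄] [NormedAlgebra ℝ 𝔄] [CompleteSpace 𝔄] (ι : Type) [Fintype ι] [DecidableEq ι] (e : 𝔄 ≃L[ℝ] (ι → ℝ)) (L : ℕ) [NeZero L] (a : ℝ)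

/-- **NE2⁰-SITE for the relative site family** (parallel-transport species), from ANY `SiteRelDatum` (`c₃₅ = 1`). [cite: King1986, Lemma 4.5 (4.38) p.674 (A = 0 template, shape)] -/
theorem ne2ZeroSite_vectorPiece_vWordsExpC_rel (hd : 1 ≤ d) (hL : 1 ≤ L) (p : ℝ)
    {WsS WsS' Ks Ks' : ∀ j : VecIndexS d L, ((Tor j.Mn × Fin (d + 1)) × ι → ℝ) →ₗ[ℝ] ((Tor j.Mn × Fin (d + 1)) × ι → ℝ)} {βS δS MS : ℝ}
    (hS : SiteRelDatum (d := d) (ι := ι) (L := L) WsS WsS' Ks Ks' βS δS MS) :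
    NE2ZeroSite 4 p (v1GVecInstance (d := d) 𝔄 ι L hL)
      (vWGCVecSiteRelKernel (d := d) 𝔄 ι e L a hL (expFc ι e L) (expFsc ι e L) (expFf ι e L) (expFsf ι e L) WsS WsS' Ks Ks') := by
  obtain ⟨hβS, hδS, hMS, hWs, hWs', hKS, hKS', hDK⟩ := hS
  exact ne2ZeroSite_of_ne2PlusSite (fun j α₀ hα₀ => reg335_one_v1GVecInstance 𝔄 ι L hL j zero_le_one hα₀.le)
    (ne2PlusSite_vectorPiece_vWordsExpC_rel (d := d) e a hd hL 1 one_pos p WsS WsS' Ks Ks' hβS hδS hMS hWs hWs' hKS hKS' hDK)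

/-- **NE2⁰-UNIT for the relative unit family** (parallel-transport species; `L ≥ 2`), from ANY `UnitRelDatum` (`c₃₅ = 1`). [cite: King1986, Lemma 4.5 (4.38) p.674 (A = 0 template, shape)] -/
theorem ne2ZeroUnit_vectorPiece_vWordsExpC_rel (hd : 1 ≤ d) (hL : 1 ≤ L) (hL2 : 2 ≤ L)
    {Ws Ws' Ku Ku' : ∀ j : VecIndexS d L, ((Tor j.Mn × Fin (d + 1)) × ι → ℝ) →ₗ[ℝ] ((Tor j.Mn × Fin (d + 1)) × ι → ℝ)} {βW δW M₀ : ℝ}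
    (hU : UnitRelDatum (d := d) (ι := ι) (L := L) Ws Ws' Ku Ku' βW δW M₀) :
    NE2ZeroUnit (v1GVecInstance (d := d) 𝔄 ι L hL)
      (vWGCVecUnitRelKernel (d := d) 𝔄 ι e L a hL (expFc ι e L) (expFsc ι e L) (expFf ι e L) (expFsf ι e L) Ws Ws' Ku Ku') (fun _ _ => True)
      (fun j => (unitTorusGeoS L j.k j.Mn j.Msz).dist) := by
  obtain ⟨hβW, hδW, hM₀, hWs, hWs', hKW, hKW', hDK⟩ := hU
  exact ne2ZeroUnit_of_ne2PlusUnit (fun j => v1GVecInstance_M_pos 𝔄 ι L hL j)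
    (fun j α₀ hα₀ => reg335_one_v1GVecInstance 𝔄 ι L hL j zero_le_one hα₀.le) (fun j α₀ hα₀ => reg336_one_v1GVecInstance 𝔄 ι L hL j zero_le_one hα₀.le)
    (ne2PlusUnit_vectorPiece_vWordsExpC_rel (d := d) e a hd hL hL2 1 one_pos Ws Ws' Ku Ku' hβW hδW hM₀ hWs hWs' hKW hKW' hDK)

end Rel

/-! ## §3 NE2⁰ at the piece's own unit forms and massive site forms — King's (4.38) shape for the model's covariances, windows only -/

section Own

variable (𝔄 : Type) [NormedRing 𝔄] [NormedAlgebra ℝ 𝔄] [CompleteSpace 𝔄] (ι : Type) [Fintype ι] [DecidableEq ι] (e : 𝔄 ≃L[ℝ] (ι → ℝ)) (L : ℕ) [NeZero L]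

/-- ★ **NE2⁰-UNIT AT THE PIECE'S OWN UNIT FORMS** (`d + 1 ≥ 2`, `L ≥ 2`, weight `0 < |a| ≤ a₀`): the two-spacing rate, King's (4.38) shape with a clean rate `θ < 1`, of the
dressed unit kernel read at `A′ = 0` — i.e. of the model's own unit covariance `(a·1 − a²Q(G ⊗ 1)Q*)⁻¹` against its `η′`-twin — NO `U ≡ 1` datum displayed. [cite: King1986, Lemma 4.5 (4.38) p.674 (A = 0 template, shape)] -/
theorem ne2ZeroUnit_vectorPiece_vWordsExpC_own (hd : 1 ≤ d) (hL : 1 ≤ L) (hL2 : 2 ≤ L) {a : ℝ} (ha : a ≠ 0) (haa : |a| ≤ ownWeightBound (d := d) ι L hd hL) :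
    NE2ZeroUnit (v1GVecInstance (d := d) 𝔄 ι L hL)
      (vWGCVecUnitRelKernel (d := d) 𝔄 ι e L a hL (expFc ι e L) (expFsc ι e L) (expFf ι e L) (expFsf ι e L) (ownUnitInvV ι L a) (ownUnitInvV' ι L a)
        (fun j => unitForm₀ a (liftMap (qbond L j.k j.Mn) ι) (tensorId ι (pieceG L j.Mn (L ^ j.k) j.k (rweight (d := d) L j.k))))
        (fun j => unitForm₀ a (liftMap (qbond L j.k j.Mn) ι ∘ liftMap (kingPrV L j.k j.m j.Mn) ι)
          (tensorId ι (pieceG L j.Mn (L ^ j.m * L ^ j.k) (j.k + j.m) (rweight (d := d) L j.k / ((L : ℝ) ^ j.m) ^ (d + 1))))))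
      (fun _ _ => True) (fun j => (unitTorusGeoS L j.k j.Mn j.Msz).dist) := by
  obtain ⟨βU, δU, M₀, -, hU⟩ := unitData_of_le_ownWeightBound (d := d) ι L hd hL ha haa
  exact ne2ZeroUnit_vectorPiece_vWordsExpC_rel 𝔄 ι e L a hd hL hL2 hU

/-- ★ **NE2⁰-SITE AT THE MASSIVE SITE FORMS** (`d + 1 ≥ 2`, `L ≥ 1`, any `p`, any weight `a`, mass `c ≥ c₀`): the two-spacing rate of the dressed site kernel read at
`A′ = 0` — i.e. of the model's massive site covariance `(c·1 + Q(G ⊗ 1)²Q*)⁻¹` against its `η′`-twin — NO `U ≡ 1` datum displayed. [cite: King1986, Lemma 4.5 (4.38) p.674 (A = 0 template, shape)] -/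
theorem ne2ZeroSite_vectorPiece_vWordsExpC_massive (hd : 1 ≤ d) (hL : 1 ≤ L) (p a : ℝ) {c : ℝ} (hcc : massBound (d := d) ι L hd hL ≤ c) :
    NE2ZeroSite 4 p (v1GVecInstance (d := d) 𝔄 ι L hL)
      (vWGCVecSiteRelKernel (d := d) 𝔄 ι e L a hL (expFc ι e L) (expFsc ι e L) (expFf ι e L) (expFsf ι e L) (msiteInvV ι L c) (msiteInvV' ι L c)
        (fun j => msiteForm c (liftMap (qbond L j.k j.Mn) ι) (tensorId ι (pieceG L j.Mn (L ^ j.k) j.k (rweight (d := d) L j.k))))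
        (fun j => msiteForm c (liftMap (qbond L j.k j.Mn) ι ∘ liftMap (kingPrV L j.k j.m j.Mn) ι)
          (tensorId ι (pieceG L j.Mn (L ^ j.m * L ^ j.k) (j.k + j.m) (rweight (d := d) L j.k / ((L : ℝ) ^ j.m) ^ (d + 1)))))) := by
  obtain ⟨βS, δS, MS, hS⟩ := siteRelDatum_of_massBound_le (d := d) ι L hd hL hcc
  exact ne2ZeroSite_vectorPiece_vWordsExpC_rel 𝔄 ι e L a hd hL p hS

end Own

end Summit.QuantumFields.YangMills.BalabanUVNodes.N15.VectorPiece

end
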